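import Literature.NumberTheory.ConnesConsani2021.FiniteRankApproximant
import Literature.NumberTheory.ConnesConsani2021.NumericalInputs
import HarnessLib

/-!
# Connes–Consani 2021 §6 spectral certificate — ROUTE A-F soundness (Fourier frame of half-integer
# frequencies; generic, no numerics)

LABEL (line 1): RH-FREE.  Generic inequalities about ONE bounded operator on `𝓗 = L²([a,b], dx)`;
nothing here mentions `ζ` or RH; nothing here bears on the truth of RH.

The obligation of record for apex input (C) of `WeilArchPositivity_soninTrace_fine` is the sign-free
operator inequality `hpos` of `MainInequalityAssembly.weilArchPositivity_soninTrace_fine_of_opIneq`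
(p. 298): `∀ ξ, 0 ≤ re⟪ξ, ξ − 𝐊_I ξ⟫ + a₀|⟪η₀, ξ⟫|²`, `𝐊_I = windowOp ϖ` (Prop. 5.5 (ii)),
`η₀ = constVector` (§6.7) [A. Connes, C. Consani, *Weil positivity and trace formula, the archimedean
place*, Selecta Math. 27 (2021) 77 = arXiv:2006.13771, §6 pp. 22–29; bib `ConnesConsani2021`].

ROUTE A-F (engine rh-crit-cc-eng-1, cc/STATUS 2026-08-26): approximate `ϖ` on `[a−b, b−a] = [−L, L]`
in `L¹` by the trigonometric kernel `τ_c = Σ_{|n| ≤ N} c_{|n|} κ_{n/2}` (`κ_α = expKernel a b α`, the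
kernel of the rank-one projection `e_α = |ξ_α⟩⟨ξ_α|`, (opkf1): `windowOp_expKernel`) at HALF-INTEGER
frequencies `α = n/2` (period `2L` harmonics); then (Lemma 6.3, `norm_windowOp_sub_windowOp_le`)
`‖𝐊_I − T‖ ≤ ε₁ := ∫|τ_c − ϖ|`, `⟪ξ|Tξ⟫ = Σ c_{|n|} |⟪ξ_{n/2}|ξ⟫|²`; the modes with `c_{|n|} ≤ 0` are
DROPPED, and the finitely many remaining ones (`|n| ≤ n₀`) are controlled by the FRAME INEQUALITY
`‖ξ‖² ≥ 2 Re Σ ū_i⟪f_i, ξ⟫ − Σ ū_i u_j ⟪f_i, f_j⟫` (expand `‖ξ − Σ u_i f_i‖² ≥ 0`) with `u = X w`,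
which reduces `Σ_{|n|≤n₀} c′_n |⟪ξ_{n/2}|ξ⟫|² ≤ μ‖ξ‖²` to positive-semidefiniteness of the real matrix
`Z = μ(2X − XGX) − diag c′` (`G` = Gram matrix `sinc(π(m−n)/2)`, `inner_expVector_expVector_symm`).
This file: the frame inequality (`frame_ineq`), the matrix reduction (`sum_mul_norm_inner_sq_le_of_psd`),
the kernel identity (`re_inner_windowOp_frameKernel`) and the assembly `opIneq_of_frameCertificate`.
No number of §6 enters. [RH-FREE; bears on the cell's bookkeeping (W-C/W-P) only through `hpos`.]

PROVENANCE: text = cc-eng-1's `cc/engine/SpectralCertSound-skeleton.lean` (sha16 12f0ad2682fec2e1, 2026-08-26),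
filed by the C-CHECK seat rh-crit-cc-t7 under the lead's R26 backup clause (cc/STATUS 05:05:05Z, R40 (3) 05:18:40Z)
VERBATIM modulo the Literature cite lint (twelve matrix-plumbing lemmas made `private`, `[cite]` locators added to
eight public theorems); no statement was changed.  Consumers: `SpectralCertCheck.lean` (certificate data + kernel
checks) and `SpectralCertificate.lean` (the one numerical fact + exports), same seat.
-/

noncomputable section

open MeasureTheory Set Complex Filter Finset
open scoped ComplexConjugate InnerProductSpace Real

namespace Literature.NumberTheory.ConnesConsani2021

namespace SpectralCert

/-! ## The frame inequality (abstract inner product space) -/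

section Frame

variable {𝕜 : Type*} {E : Type*} [RCLike 𝕜] [NormedAddCommGroup E] [InnerProductSpace 𝕜 E]

/-- RH-FREE. **Frame inequality**: for any finite family `f`, coefficients `u` and vector `ξ`,
`2 Re Σ_i ū_i ⟪f_i, ξ⟫ − Re Σ_i Σ_j ū_i u_j ⟪f_i, f_j⟫ ≤ ‖ξ‖²` (this is `0 ≤ ‖ξ − Σ_i u_i f_i‖²` expanded).
[cite: ConnesConsani2021, §6.6 Lemma 6.6 proof pp. 25–26 (expanding `‖ξ − Pξ‖² ≥ 0` against the Gram matrix of the exponentials); folklore: the frame / Bessel-type inequality] -/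
theorem frame_ineq {ι : Type*} (s : Finset ι) (f : ι → E) (u : ι → 𝕜) (ξ : E) :
    2 * RCLike.re (∑ i ∈ s, conj (u i) * ⟪f i, ξ⟫_𝕜)
        - RCLike.re (∑ i ∈ s, ∑ j ∈ s, conj (u i) * u j * ⟪f i, f j⟫_𝕜) ≤ ‖ξ‖ ^ 2 := by
  set ζ : E := ∑ i ∈ s, u i • f i with hζ
  have h1 : ⟪ζ, ξ⟫_𝕜 = ∑ i ∈ s, conj (u i) * ⟪f i, ξ⟫_𝕜 := by
    rw [hζ, sum_inner]
    refine Finset.sum_congr rfl fun i _ ↦ ?_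
    rw [inner_smul_left]
  have h2 : ⟪ζ, ζ⟫_𝕜 = ∑ i ∈ s, ∑ j ∈ s, conj (u i) * u j * ⟪f i, f j⟫_𝕜 := by
    conv_lhs => rw [hζ]
    rw [sum_inner]
    refine Finset.sum_congr rfl fun i _ ↦ ?_
    rw [inner_smul_left, inner_sum, Finset.mul_sum]
    refine Finset.sum_congr rfl fun j _ ↦ ?_
    rw [inner_smul_right, mul_assoc]
  have h3 : ‖ξ - ζ‖ ^ 2 = ‖ξ‖ ^ 2 - 2 * RCLike.re ⟪ξ, ζ⟫_𝕜 + ‖ζ‖ ^ 2 := norm_sub_sq (𝕜 := 𝕜) ξ ζ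
  have h4 : RCLike.re ⟪ξ, ζ⟫_𝕜 = RCLike.re ⟪ζ, ξ⟫_𝕜 := by
    rw [← inner_conj_symm, RCLike.conj_re]
  have h5 : ‖ζ‖ ^ 2 = RCLike.re ⟪ζ, ζ⟫_𝕜 := (inner_self_eq_norm_sq (𝕜 := 𝕜) ζ).symm
  rw [← h1, ← h2, ← h5, ← h4]
  nlinarith [sq_nonneg ‖ξ - ζ‖, h3]

end Frame

/-! ## From a real PSD certificate to `Σ c_i |⟪f_i, ξ⟫|² ≤ μ ‖ξ‖²` (complex Hilbert space, real data) -/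

section RealCert

open Matrix

variable {E : Type*} [NormedAddCommGroup E] [InnerProductSpace ℂ E]
variable {M : ℕ}

/-- A real matrix viewed as a complex one. [folklore] -/
def toC (A : Matrix (Fin M) (Fin M) ℝ) : Matrix (Fin M) (Fin M) ℂ := A.map (algebraMap ℝ ℂ)

/-- Entries of `toC A`. [folklore] -/
@[simp] private theorem toC_apply (A : Matrix (Fin M) (Fin M) ℝ) (i j : Fin M) : toC A i j = ((A i j : ℝ) : ℂ) := rfl

/-- `toC` is multiplicative. [folklore] -/
private theorem toC_mul (A B : Matrix (Fin M) (Fin M) ℝ) : toC (A * B) = toC A * toC B := by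
  unfold toC; exact Matrix.map_mul

/-- The conjugate transpose of `toC X` for a real symmetric `X` is itself. [folklore] -/
private theorem conjTranspose_toC_of_symm {X : Matrix (Fin M) (Fin M) ℝ} (hXs : ∀ i j, X i j = X j i) :
    (toC X)ᴴ = toC X := by
  ext i j
  rw [conjTranspose_apply, toC_apply, toC_apply, hXs j i, Complex.star_def, Complex.conj_ofReal]

/-- The real quadratic form `x ↦ Σ_i Σ_j A_ij x_i x_j`. [folklore] -/
def qform (A : Matrix (Fin M) (Fin M) ℝ) (x : Fin M → ℝ) : ℝ := ∑ i, ∑ j, A i j * (x i * x j)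

/-- The sesquilinear form `w ↦ w̄ ⬝ (A w) = Σ_i Σ_j A_ij w̄_i w_j` of a real matrix on complex vectors. [folklore] -/
def cform (A : Matrix (Fin M) (Fin M) ℝ) (w : Fin M → ℂ) : ℂ := star w ⬝ᵥ (toC A *ᵥ w)

/-- `cform` as a double sum. [folklore] -/
private theorem cform_eq_sum (A : Matrix (Fin M) (Fin M) ℝ) (w : Fin M → ℂ) :
    cform A w = ∑ i, ∑ j, (A i j : ℂ) * (conj (w i) * w j) := by
  simp only [cform, dotProduct, mulVec, toC_apply, Pi.star_apply, Complex.star_def, Finset.mul_sum]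
  refine Finset.sum_congr rfl fun i _ ↦ Finset.sum_congr rfl fun j _ ↦ ?_
  ring

/-- `Re Σ A_ij w̄_i w_j = Σ A_ij (p_i p_j + q_i q_j)`, `w = p + iq`. [folklore] -/
private theorem re_cform (A : Matrix (Fin M) (Fin M) ℝ) (w : Fin M → ℂ) :
    (cform A w).re = qform A (fun i ↦ (w i).re) + qform A (fun i ↦ (w i).im) := by
  rw [cform_eq_sum]
  simp only [qform, Complex.re_sum, ← Finset.sum_add_distrib]
  refine Finset.sum_congr rfl fun i _ ↦ Finset.sum_congr rfl fun j _ ↦ ?_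
  simp only [Complex.mul_re, Complex.ofReal_re, Complex.ofReal_im, Complex.mul_im, Complex.conj_re,
    Complex.conj_im]
  ring

/-- `cform` is additive in the matrix. [folklore] -/
private theorem cform_add (A B : Matrix (Fin M) (Fin M) ℝ) (w : Fin M → ℂ) :
    cform (A + B) w = cform A w + cform B w := by
  simp only [cform_eq_sum, Matrix.add_apply, Complex.ofReal_add, add_mul, Finset.sum_add_distrib]

/-- `cform` is homogeneous in the matrix. [folklore] -/
private theorem cform_smul (r : ℝ) (A : Matrix (Fin M) (Fin M) ℝ) (w : Fin M → ℂ) :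
    cform (r • A) w = (r : ℂ) * cform A w := by
  simp only [cform_eq_sum, Matrix.smul_apply, smul_eq_mul, Complex.ofReal_mul, mul_assoc, Finset.mul_sum]

/-- `cform` respects subtraction in the matrix. [folklore] -/
private theorem cform_sub (A B : Matrix (Fin M) (Fin M) ℝ) (w : Fin M → ℂ) :
    cform (A - B) w = cform A w - cform B w := by
  simp only [cform_eq_sum, Matrix.sub_apply, Complex.ofReal_sub, sub_mul, Finset.sum_sub_distrib]

/-- The form of a diagonal matrix: `Σ c_i |w_i|²`. [folklore] -/
private theorem re_cform_diagonal (c : Fin M → ℝ) (w : Fin M → ℂ) :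
    (cform (Matrix.diagonal c) w).re = ∑ i, c i * ‖w i‖ ^ 2 := by
  rw [cform_eq_sum, Complex.re_sum]
  refine Finset.sum_congr rfl fun i _ ↦ ?_
  rw [Finset.sum_eq_single i]
  · rw [Matrix.diagonal_apply_eq, Complex.conj_mul', ← Complex.ofReal_pow, ← Complex.ofReal_mul,
      Complex.ofReal_re]
  · intro j _ hj
    rw [Matrix.diagonal_apply_ne _ (Ne.symm hj), Complex.ofReal_zero, zero_mul]
  · intro h; exact absurd (Finset.mem_univ i) h

/-- The certificate matrix `Z = μ(2X − XGX) − diag c`. [folklore] -/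
def certMatrix (G X : Matrix (Fin M) (Fin M) ℝ) (c : Fin M → ℝ) (μ : ℝ) : Matrix (Fin M) (Fin M) ℝ :=
  μ • ((2 : ℝ) • X - X * G * X) - Matrix.diagonal c

/-- RH-FREE. **Frame inequality in coordinates**: with `w_i = ⟪f_i, ξ⟫`, real symmetric `X` and real
Gram matrix `G_ij = ⟪f_i, f_j⟫`, `2 Re(w̄ᵀXw) − Re(w̄ᵀ XGX w) ≤ ‖ξ‖²` (the frame inequality with
`u = Xw`). [cite: ConnesConsani2021, §6.6 Lemma 6.6 proof pp. 25–26 (Gram matrix of the exponentials); folklore] -/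
theorem frame_coords (f : Fin M → E) (G X : Matrix (Fin M) (Fin M) ℝ)
    (hG : ∀ i j, ⟪f i, f j⟫_ℂ = ((G i j : ℝ) : ℂ)) (hXs : ∀ i j, X i j = X j i) (ξ : E) :
    2 * (cform X (fun i ↦ ⟪f i, ξ⟫_ℂ)).re - (cform (X * G * X) (fun i ↦ ⟪f i, ξ⟫_ℂ)).re ≤ ‖ξ‖ ^ 2 := by
  set w : Fin M → ℂ := fun i ↦ ⟪f i, ξ⟫_ℂ with hw
  set u : Fin M → ℂ := toC X *ᵥ w with hu
  have hframe := frame_ineq (𝕜 := ℂ) Finset.univ f u ξ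
  have hstar : star u = star w ᵥ* toC X := by
    rw [hu, star_mulVec, conjTranspose_toC_of_symm hXs]
  have hA : ∑ i, conj (u i) * ⟪f i, ξ⟫_ℂ = cform X w := by
    change star u ⬝ᵥ w = _
    rw [hstar, ← dotProduct_mulVec]; rfl
  have hGmat : ∀ i, ∑ j, conj (u i) * u j * ⟪f i, f j⟫_ℂ = conj (u i) * (toC G *ᵥ u) i := fun i ↦ by
    simp only [mulVec, dotProduct, toC_apply, hG, Finset.mul_sum]
    refine Finset.sum_congr rfl fun j _ ↦ ?_
    ring
  have hB : ∑ i, ∑ j, conj (u i) * u j * ⟪f i, f j⟫_ℂ = cform (X * G * X) w := by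
    simp only [hGmat]
    change star u ⬝ᵥ (toC G *ᵥ u) = _
    rw [hstar, ← dotProduct_mulVec, hu, mulVec_mulVec, mulVec_mulVec, ← toC_mul, ← toC_mul]
    rfl
  rw [hA, hB] at hframe
  simpa only [RCLike.re_to_complex] using hframe

/-- RH-FREE. **Matrix reduction of the frame inequality.**  Let `f : Fin M → E` have REAL Gram matrix
`G` (`⟪f_i, f_j⟫ = G_ij`), `X` real symmetric, `c` real, `0 ≤ μ`, and suppose the real matrix
`Z = μ(2X − XGX) − diag c` is positive semidefinite on real vectors.  Then `Σ_i c_i |⟪f_i, ξ⟫|² ≤ μ ‖ξ‖²`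
for every `ξ`. [cite: ConnesConsani2021, §6.6 Lemma 6.6 pp. 25–26 with §6.7 Lemma 6.10 p. 28 (finite block of exponentials controlling `re⟪ξ, Tξ⟫`); folklore] -/
theorem sum_mul_norm_inner_sq_le_of_psd (f : Fin M → E) (G X : Matrix (Fin M) (Fin M) ℝ)
    (c : Fin M → ℝ) {μ : ℝ} (hμ : 0 ≤ μ)
    (hG : ∀ i j, ⟪f i, f j⟫_ℂ = ((G i j : ℝ) : ℂ)) (hXs : ∀ i j, X i j = X j i)
    (hZ : ∀ x : Fin M → ℝ, 0 ≤ qform (certMatrix G X c μ) x) (ξ : E) :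
    ∑ i, c i * ‖⟪f i, ξ⟫_ℂ‖ ^ 2 ≤ μ * ‖ξ‖ ^ 2 := by
  set w : Fin M → ℂ := fun i ↦ ⟪f i, ξ⟫_ℂ with hw
  have hfr := frame_coords f G X hG hXs ξ
  have hZw : 0 ≤ (cform (certMatrix G X c μ) w).re := by
    rw [re_cform]; exact add_nonneg (hZ _) (hZ _)
  have hdiag : (cform (Matrix.diagonal c) w).re = ∑ i, c i * ‖⟪f i, ξ⟫_ℂ‖ ^ 2 := re_cform_diagonal c w
  rw [certMatrix, cform_sub, Complex.sub_re, cform_smul, Complex.re_ofReal_mul, cform_sub, cform_smul,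
    Complex.sub_re, Complex.re_ofReal_mul, hdiag] at hZw
  nlinarith [mul_le_mul_of_nonneg_left hfr hμ]

end RealCert

/-! ## The frame kernel `τ_c = Σ_{|n| ≤ N} c_{|n|} κ_{n/2}` and `re⟪ξ, windowOp τ_c ξ⟫` -/

section Kernel

variable {a b : ℝ}

/-- RH-FREE. The trigonometric kernel of half-integer frequencies `τ_c(v) = Σ_{|n| ≤ N} c_{|n|} κ_{n/2}(v)`,
`κ_α = expKernel a b α = L⁻¹e^{2πiαv/L}` (so `τ_c(v) = L⁻¹(c₀ + 2Σ_{n=1}^{N} c_n cos(πnv/L))`, period `2L`).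
[cite: ConnesConsani2021, §6.4 display (opkf1) p. 24] -/
def frameKernel (a b : ℝ) (N : ℕ) (c : ℕ → ℝ) (v : ℝ) : ℂ :=
  ∑ n ∈ Finset.Icc (-(N : ℤ)) N, ((c n.natAbs : ℝ) : ℂ) * expKernel a b ((n : ℝ) / 2) v

/-- `τ_c` is continuous. [cite: ConnesConsani2021, §6.4 display (opkf1) p. 24 (the trigonometric kernel `τ`)] -/
theorem continuous_frameKernel (a b : ℝ) (N : ℕ) (c : ℕ → ℝ) : Continuous (frameKernel a b N c) := by
  unfold frameKernel
  exact continuous_finsetSum _ fun n _ ↦ continuous_const.mul (continuous_expKernel a b _)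

/-- `τ_c ∈ L¹` of the window. [cite: ConnesConsani2021, §6.4 display (opkf1) and Lemma 6.3 p. 24 (`τ ∈ L¹` of the doubled window)] -/
theorem integrableOn_frameKernel (a b : ℝ) (N : ℕ) (c : ℕ → ℝ) :
    IntegrableOn (frameKernel a b N c) (Icc (a - b) (b - a)) :=
  integrableOn_window_of_continuous (continuous_frameKernel a b N c)

/-- RH-FREE. **`Re⟪ξ | windowOp τ_c ξ⟫ = Σ_{|n| ≤ N} c_{|n|} |⟪ξ_{n/2}|ξ⟫|²`** ((opkf1) termwise:
`windowOp κ_α = e_α = |ξ_α⟩⟨ξ_α|`). [cite: ConnesConsani2021, §6.4 display (opkf1) p. 24] -/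
theorem re_inner_windowOp_frameKernel (hab : a < b) (N : ℕ) (c : ℕ → ℝ)
    (ξ : Lp ℂ 2 (volume.restrict (Icc a b))) :
    RCLike.re ⟪ξ, windowOp a b (integrableOn_frameKernel a b N c) ξ⟫_ℂ
      = ∑ n ∈ Finset.Icc (-(N : ℤ)) N, c n.natAbs * ‖⟪expVector a b ((n : ℝ) / 2), ξ⟫_ℂ‖ ^ 2 := by
  rw [inner_windowOp]
  have hsum : windowForm a b (frameKernel a b N c) ξ ξ
      = ∑ n ∈ Finset.Icc (-(N : ℤ)) N,
          windowForm a b (fun v ↦ ((c n.natAbs : ℝ) : ℂ) * expKernel a b ((n : ℝ) / 2) v) ξ ξ :=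
    windowForm_finset_sum_kernel (Finset.Icc (-(N : ℤ)) N)
      (fun n _ ↦ (integrableOn_expKernel a b ((n : ℝ) / 2)).const_mul _) ξ ξ
  rw [hsum, RCLike.re_to_complex, Complex.re_sum]
  refine Finset.sum_congr rfl fun n _ ↦ ?_
  rw [windowForm_const_mul_kernel, windowForm_expKernel_self hab, ← Complex.ofReal_mul, Complex.ofReal_re]

end Kernel

/-! ## Assembly: the sign-free operator inequality `hpos` from an `L¹` kernel bound, the sign data and the low block -/

section Main

variable {a b : ℝ}

/-- RH-FREE. **The frame certificate ⇒ `hpos`.**  Let `𝐊 = windowOp ϖ` on `L²([a,b])` and let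
`τ_c = Σ_{|n|≤N} c_{|n|} κ_{n/2}` be a trigonometric kernel with `∫_{a−b}^{b−a}|τ_c − ϖ| ≤ ε₁` (so
`‖𝐊 − windowOp τ_c‖ ≤ ε₁`, Lemma 6.3), `c_n ≤ 0` for `n₀ < n ≤ N`, and suppose the LOW BLOCK inequality
`Σ_{|n|≤n₀} (c_{|n|} − a₀[n=0]) |⟪ξ_{n/2}|ξ⟫|² ≤ μ‖ξ‖²` holds for all `ξ` with `μ + ε₁ ≤ 1`.  Then
`0 ≤ Re⟪ξ, ξ − 𝐊ξ⟫ + a₀|⟪η₀, ξ⟫|²` for every `ξ` (`η₀ = constVector = ξ_0`).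
[cite: ConnesConsani2021, Lemma 6.3 §6.4 p. 24; Lemma 6.10 §6.7 p. 28 (the role of `hpos`)] -/
theorem opIneq_of_frameCertificate (hab : a < b) {ϖ : ℝ → ℂ}
    (hϖ : IntegrableOn ϖ (Icc (a - b) (b - a))) {N n₀ : ℕ} (hn : n₀ ≤ N) (c : ℕ → ℝ) {ε₁ μ a₀ : ℝ}
    (hL1 : ∫ v in Icc (a - b) (b - a), ‖frameKernel a b N c v - ϖ v‖ ≤ ε₁)
    (hμ : μ + ε₁ ≤ 1)
    (hneg : ∀ n : ℕ, n₀ < n → n ≤ N → c n ≤ 0)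
    (hlow : ∀ ξ : Lp ℂ 2 (volume.restrict (Icc a b)),
      ∑ n ∈ Finset.Icc (-(n₀ : ℤ)) n₀,
          (c n.natAbs - if n = 0 then a₀ else 0) * ‖⟪expVector a b ((n : ℝ) / 2), ξ⟫_ℂ‖ ^ 2
        ≤ μ * ‖ξ‖ ^ 2)
    (ξ : Lp ℂ 2 (volume.restrict (Icc a b))) :
    0 ≤ RCLike.re ⟪ξ, ξ - windowOp a b hϖ ξ⟫_ℂ + a₀ * ‖⟪constVector a b, ξ⟫_ℂ‖ ^ 2 := by
  set K := windowOp a b hϖ with hK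
  set T := windowOp a b (integrableOn_frameKernel a b N c) with hT
  set r : ℤ → ℝ := fun n ↦ ‖⟪expVector a b ((n : ℝ) / 2), ξ⟫_ℂ‖ ^ 2 with hr
  -- Lemma 6.3: ‖K − T‖ ≤ ε₁
  have hKT : ‖K - T‖ ≤ ε₁ :=
    (norm_windowOp_sub_windowOp_le hϖ (integrableOn_frameKernel a b N c)).trans hL1
  -- Re⟪ξ, Kξ⟫ ≤ Re⟪ξ, Tξ⟫ + ε₁‖ξ‖²
  have h1 : RCLike.re ⟪ξ, K ξ⟫_ℂ ≤ RCLike.re ⟪ξ, T ξ⟫_ℂ + ε₁ * ‖ξ‖ ^ 2 := by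
    have hsplit : ⟪ξ, K ξ⟫_ℂ = ⟪ξ, T ξ⟫_ℂ + ⟪ξ, (K - T) ξ⟫_ℂ := by
      rw [show (K - T) ξ = K ξ - T ξ from rfl, inner_sub_right]; ring
    rw [hsplit, map_add]
    have hb : RCLike.re ⟪ξ, (K - T) ξ⟫_ℂ ≤ ε₁ * ‖ξ‖ ^ 2 :=
      calc RCLike.re ⟪ξ, (K - T) ξ⟫_ℂ ≤ ‖⟪ξ, (K - T) ξ⟫_ℂ‖ := RCLike.re_le_norm _
        _ ≤ ‖ξ‖ * ‖(K - T) ξ‖ := norm_inner_le_norm _ _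
        _ ≤ ‖ξ‖ * (‖K - T‖ * ‖ξ‖) := by gcongr; exact (K - T).le_opNorm ξ
        _ ≤ ‖ξ‖ * (ε₁ * ‖ξ‖) := by gcongr
        _ = ε₁ * ‖ξ‖ ^ 2 := by ring
    linarith
  -- Re⟪ξ, Tξ⟫ = Σ_{|n|≤N} c r_n ≤ Σ_{|n|≤n₀} c r_n
  have h2 : RCLike.re ⟪ξ, T ξ⟫_ℂ = ∑ n ∈ Finset.Icc (-(N : ℤ)) N, c n.natAbs * r n :=
    re_inner_windowOp_frameKernel hab N c ξ
  have hsub : Finset.Icc (-(n₀ : ℤ)) n₀ ⊆ Finset.Icc (-(N : ℤ)) N :=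
    Finset.Icc_subset_Icc (by omega) (by omega)
  have h3 : ∑ n ∈ Finset.Icc (-(N : ℤ)) N, c n.natAbs * r n
      ≤ ∑ n ∈ Finset.Icc (-(n₀ : ℤ)) n₀, c n.natAbs * r n := by
    rw [← Finset.sum_sdiff hsub]
    have hneg' : ∑ n ∈ Finset.Icc (-(N : ℤ)) N \ Finset.Icc (-(n₀ : ℤ)) n₀, c n.natAbs * r n ≤ 0 := by
      refine Finset.sum_nonpos fun n hn' ↦ ?_
      rw [Finset.mem_sdiff, Finset.mem_Icc, Finset.mem_Icc] at hn'
      have hcn : c n.natAbs ≤ 0 := hneg _ (by omega) (by omega)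
      exact mul_nonpos_of_nonpos_of_nonneg hcn (by positivity)
    linarith
  -- the low block, with the `a₀` term separated
  have h4 : ∑ n ∈ Finset.Icc (-(n₀ : ℤ)) n₀, (c n.natAbs - if n = 0 then a₀ else 0) * r n
      = ∑ n ∈ Finset.Icc (-(n₀ : ℤ)) n₀, c n.natAbs * r n - a₀ * r 0 := by
    simp only [sub_mul, Finset.sum_sub_distrib, ite_mul, zero_mul]
    rw [Finset.sum_ite_eq' (Finset.Icc (-(n₀ : ℤ)) n₀) (0 : ℤ) (fun n ↦ a₀ * r n)]
    simp
  have h5 := hlow ξ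
  rw [h4] at h5
  -- `η₀ = ξ_0`
  have h0 : ‖⟪constVector a b, ξ⟫_ℂ‖ ^ 2 = r 0 := by
    simp only [hr, Int.cast_zero, zero_div, expVector_zero_eq_constVector]
  -- Re⟪ξ, ξ − Kξ⟫ = ‖ξ‖² − Re⟪ξ, Kξ⟫
  have h6 : RCLike.re ⟪ξ, ξ - K ξ⟫_ℂ = ‖ξ‖ ^ 2 - RCLike.re ⟪ξ, K ξ⟫_ℂ := by
    rw [inner_sub_right, map_sub, inner_self_eq_norm_sq (𝕜 := ℂ)]
  rw [h6, h0]
  nlinarith [h1, h2, h3, h5, sq_nonneg ‖ξ‖]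

end Main

/-! ## The Gram matrix of the half-integer frequencies on `[−L/2, L/2]`: `G = 1 + π⁻¹ S`, `S` rational -/

section Gram

/-- `halfSinc d = sinc(π d / 2)`, the Gram entry `⟪ξ_{m/2}, ξ_{n/2}⟫` for `d = n − m`. [folklore] -/
def halfSinc (d : ℤ) : ℝ := Real.sinc (π * ((d : ℝ) / 2))

/-- The rational part: `halfSinc d = [d = 0] + π⁻¹ · halfSincRat d`, with `halfSincRat d = 0` for even `d` and
`= 2(−1)^k/|d|` for `|d| = 2k + 1`. [folklore] -/
def halfSincRat (d : ℤ) : ℚ :=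
  if Even d then 0 else 2 * (-1) ^ ((d.natAbs - 1) / 2) / d.natAbs

/-- RH-FREE. **Gram matrix of the half-integer exponentials** on CC's symmetric window:
`⟪ξ_{m/2}, ξ_{n/2}⟫ = sinc(π(n − m)/2)`. [cite: ConnesConsani2021, Lemma 6.6 §6.6 pp. 25–26 (proof)] -/
theorem inner_expVector_halfInt {L : ℝ} (hL : 0 < L) (m n : ℤ) :
    ⟪expVector (-(L / 2)) (L / 2) ((m : ℝ) / 2), expVector (-(L / 2)) (L / 2) ((n : ℝ) / 2)⟫_ℂ
      = ((halfSinc (n - m) : ℝ) : ℂ) := by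
  rw [inner_expVector_expVector_symm hL, halfSinc]
  congr 3
  push_cast
  ring

/-- `sinc(π m/2)` for a natural number `m`: `1`, `0` (even `m ≠ 0`), `2(−1)^k/(π m)` (`m = 2k+1`). [folklore] -/
private theorem sinc_pi_mul_nat_div_two (m : ℕ) :
    Real.sinc (π * ((m : ℝ) / 2))
      = if m = 0 then 1 else if Even m then 0 else 2 * (-1 : ℝ) ^ ((m - 1) / 2) / (π * m) := by
  rcases Nat.eq_zero_or_pos m with rfl | hm
  · simp
  have hne : π * ((m : ℝ) / 2) ≠ 0 := by positivity
  rw [if_neg hm.ne', Real.sinc_of_ne_zero hne]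
  rcases Nat.even_or_odd m with ⟨k, rfl⟩ | ⟨k, rfl⟩
  · rw [if_pos ⟨k, rfl⟩]
    have : π * (((k + k : ℕ) : ℝ) / 2) = (k : ℕ) * π := by push_cast; ring
    rw [this, Real.sin_nat_mul_pi, zero_div]
  · have hodd : ¬ Even (2 * k + 1) := Nat.not_even_iff_odd.2 ⟨k, rfl⟩
    rw [if_neg hodd]
    have harg : π * (((2 * k + 1 : ℕ) : ℝ) / 2) = π / 2 + (k : ℕ) * π := by push_cast; ring
    rw [harg, Real.sin_add_nat_mul_pi, Real.sin_pi_div_two, mul_one,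
      show (2 * k + 1 - 1) / 2 = k by omega]
    have hk : (π / 2 + (k : ℝ) * π) = π * (2 * k + 1) / 2 := by ring
    rw [hk]
    push_cast
    field_simp

/-- RH-FREE. **Closed form**: `halfSinc d = [d = 0] + π⁻¹ · halfSincRat d` — so the Gram matrix of the
half-integer exponentials is `1 + π⁻¹ S` with `S` RATIONAL. [cite: ConnesConsani2021, §6.6 Lemma 6.6 proof pp. 25–26 (`⟪ξ_α, ξ_β⟫ = sin(π(α−β))/(π(α−β))` on the symmetric window); folklore] -/
theorem halfSinc_eq (d : ℤ) :
    halfSinc d = (if d = 0 then 1 else 0) + π⁻¹ * ((halfSincRat d : ℚ) : ℝ) := by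
  -- reduce to `d ≥ 0` by evenness of `sinc`
  have key : ∀ m : ℕ, halfSinc m = (if (m : ℤ) = 0 then 1 else 0) + π⁻¹ * ((halfSincRat m : ℚ) : ℝ) := by
    intro m
    rw [halfSinc, Int.cast_natCast, sinc_pi_mul_nat_div_two, halfSincRat]
    simp only [Int.natAbs_natCast, Int.even_coe_nat, Nat.cast_eq_zero]
    by_cases h0 : m = 0
    · subst h0; simp
    rw [if_neg h0, if_neg h0]
    by_cases he : Even m
    · rw [if_pos he, if_pos he]; simp
    rw [if_neg he, if_neg he, zero_add]
    push_cast
    field_simp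
  rcases Int.natAbs_eq d with h | h
  · conv_lhs => rw [h]
    rw [key, ← h]
  · have hneg : halfSinc d = halfSinc d.natAbs := by
      rw [halfSinc, halfSinc]
      conv_lhs => rw [h]
      rw [Int.cast_neg, Int.cast_natCast, neg_div, mul_neg, Real.sinc_neg]
    rw [hneg, key]
    have h1 : ((d.natAbs : ℤ) = 0) ↔ d = 0 := by omega
    have h2 : halfSincRat (d.natAbs : ℤ) = halfSincRat d := by
      simp only [halfSincRat, Int.natAbs_natCast, Int.even_coe_nat, Int.natAbs_even]
    simp only [h1, h2]

end Gram

/-! ## The affine-in-`t` vertex step and the transport of rational PSD certificates -/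

section Vertex

open Matrix

variable {M : ℕ}

/-- `qform` is additive in the matrix. [folklore] -/
private theorem qform_sub (A B : Matrix (Fin M) (Fin M) ℝ) (x : Fin M → ℝ) :
    qform (A - B) x = qform A x - qform B x := by
  simp only [qform, Matrix.sub_apply, sub_mul, Finset.sum_sub_distrib]

/-- `qform` is homogeneous in the matrix. [folklore] -/
private theorem qform_smul (r : ℝ) (A : Matrix (Fin M) (Fin M) ℝ) (x : Fin M → ℝ) :
    qform (r • A) x = r * qform A x := by
  simp only [qform, Matrix.smul_apply, smul_eq_mul, mul_assoc, Finset.mul_sum]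

/-- RH-FREE. **Vertex step**: a matrix pencil `Z₀ − t Z₁` that is PSD at `t = t₋` and at `t = t₊` is PSD
for every `t ∈ [t₋, t₊]` (the quadratic form is affine in `t`). [cite: ConnesConsani2021, §6.6 pp. 25–26 (the Gram data are affine in the single transcendental `π⁻¹`); folklore: a quadratic form affine in a parameter is nonnegative on an interval iff at its endpoints] -/
theorem qform_nonneg_of_endpoints (Z₀ Z₁ : Matrix (Fin M) (Fin M) ℝ) {tlo thi t : ℝ}
    (hlo : tlo ≤ t) (hhi : t ≤ thi)
    (h₀ : ∀ x, 0 ≤ qform (Z₀ - tlo • Z₁) x) (h₁ : ∀ x, 0 ≤ qform (Z₀ - thi • Z₁) x)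
    (x : Fin M → ℝ) : 0 ≤ qform (Z₀ - t • Z₁) x := by
  have e : ∀ s : ℝ, qform (Z₀ - s • Z₁) x = qform Z₀ x - s * qform Z₁ x := fun s ↦ by
    rw [qform_sub, qform_smul]
  have a := h₀ x; have b := h₁ x
  rw [e] at a b ⊢
  rcases le_or_gt 0 (qform Z₁ x) with hq | hq
  · nlinarith
  · nlinarith

/-- `qform` of a rational matrix cast to `ℝ` is the quadratic form `x ⬝ (M x)`. [folklore] -/
private theorem qform_eq_dotProduct (A : Matrix (Fin M) (Fin M) ℝ) (x : Fin M → ℝ) :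
    qform A x = x ⬝ᵥ (A *ᵥ x) := by
  simp only [qform, dotProduct, mulVec, Finset.mul_sum]
  refine Finset.sum_congr rfl fun i _ ↦ Finset.sum_congr rfl fun j _ ↦ ?_
  ring

/-- RH-FREE. **Transport**: a positive semidefinite rational matrix (e.g. certified by an exact `LDLᵀ`
witness, `Literature.Analysis.ValidatedNumerics.PSDCert.posSemidef_map_of_ldltCheck`) has nonnegative
real quadratic form. [cite: ConnesConsani2021, §6.7 Lemma 6.10 p. 28 (positivity of the finite block); folklore: `Matrix.PosSemidef` ⇒ nonnegative real quadratic form] -/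
theorem qform_nonneg_of_posSemidef {Mq : Matrix (Fin M) (Fin M) ℚ}
    (h : (Mq.map (Rat.castHom ℝ)).PosSemidef) (x : Fin M → ℝ) :
    0 ≤ qform (Mq.map (Rat.castHom ℝ)) x := by
  rw [qform_eq_dotProduct]
  have h2 := (Matrix.posSemidef_iff_dotProduct_mulVec.1 h).2 x
  simpa using h2

end Vertex

/-! ## The low block on CC's window from RATIONAL data: `G = 1 + π⁻¹ S`, `Z(t) = Z₀ − t Z₁` -/

section LowBlock

open Matrix

variable {m : ℕ}

/-- The rational matrix `S_ij = halfSincRat(j − i)` (so that the Gram matrix of `(ξ_{(i−n₀)/2})_i` is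
`1 + π⁻¹ S`). [folklore] -/
def sRat (m : ℕ) : Matrix (Fin m) (Fin m) ℚ := Matrix.of fun i j ↦ halfSincRat ((j : ℤ) - (i : ℤ))

/-- `Z₀ = μ(2X − X²) − diag c′` (rational). [folklore] -/
def zRat₀ (X : Matrix (Fin m) (Fin m) ℚ) (c' : Fin m → ℚ) (μ : ℚ) : Matrix (Fin m) (Fin m) ℚ :=
  μ • ((2 : ℚ) • X - X * X) - Matrix.diagonal c'

/-- `Z₁ = μ XSX` (rational). [folklore] -/
def zRat₁ (X : Matrix (Fin m) (Fin m) ℚ) (μ : ℚ) : Matrix (Fin m) (Fin m) ℚ := μ • (X * sRat m * X)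

/-- The certificate pencil `Z(t) = Z₀ − t Z₁` (rational, AFFINE in `t`; evaluated at `t = π⁻¹` it is
`certMatrix G X c′ μ` for `G = 1 + π⁻¹S`). [folklore] -/
def zRat (X : Matrix (Fin m) (Fin m) ℚ) (c' : Fin m → ℚ) (μ t : ℚ) : Matrix (Fin m) (Fin m) ℚ :=
  zRat₀ X c' μ - t • zRat₁ X μ

/-- Casting the pencil: `(Z₀ − tZ₁).map = Z₀.map − t • Z₁.map`. [folklore] -/
private theorem map_zRat (X : Matrix (Fin m) (Fin m) ℚ) (c' : Fin m → ℚ) (μ t : ℚ) :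
    (zRat X c' μ t).map (Rat.castHom ℝ)
      = (zRat₀ X c' μ).map (Rat.castHom ℝ) - (t : ℝ) • (zRat₁ X μ).map (Rat.castHom ℝ) := by
  ext i j
  simp [zRat, Matrix.sub_apply, Matrix.smul_apply]

/-- Cast of `Z₀`. [folklore] -/
private theorem map_zRat₀ (X : Matrix (Fin m) (Fin m) ℚ) (c' : Fin m → ℚ) (μ : ℚ) :
    (zRat₀ X c' μ).map (Rat.castHom ℝ)
      = (μ : ℝ) • ((2 : ℝ) • X.map (Rat.castHom ℝ) - X.map (Rat.castHom ℝ) * X.map (Rat.castHom ℝ))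
        - Matrix.diagonal (fun i ↦ (c' i : ℝ)) := by
  ext i j
  simp only [zRat₀, Matrix.map_apply, Matrix.sub_apply, Matrix.smul_apply, Matrix.mul_apply,
    Matrix.diagonal_apply, smul_eq_mul, eq_ratCast]
  split_ifs <;> push_cast <;> ring

/-- Cast of `Z₁`. [folklore] -/
private theorem map_zRat₁ (X : Matrix (Fin m) (Fin m) ℚ) (μ : ℚ) :
    (zRat₁ X μ).map (Rat.castHom ℝ)
      = (μ : ℝ) • (X.map (Rat.castHom ℝ) * (sRat m).map (Rat.castHom ℝ) * X.map (Rat.castHom ℝ)) := by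
  ext i j
  simp only [zRat₁, Matrix.map_apply, Matrix.smul_apply, Matrix.mul_apply, smul_eq_mul, eq_ratCast]
  push_cast
  simp only [Finset.mul_sum, Finset.sum_mul]

/-- The Gram matrix of the half-integer exponentials is `1 + π⁻¹ S`. [folklore] -/
private theorem gram_eq_one_add (m : ℕ) :
    (Matrix.of fun i j : Fin m ↦ halfSinc ((j : ℤ) - (i : ℤ)))
      = 1 + (π⁻¹ : ℝ) • (sRat m).map (Rat.castHom ℝ) := by
  ext i j
  simp only [Matrix.of_apply, halfSinc_eq, Matrix.add_apply, Matrix.one_apply, Matrix.smul_apply,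
    Matrix.map_apply, sRat, smul_eq_mul, eq_ratCast]
  congr 1
  by_cases h : i = j
  · subst h; simp
  · rw [if_neg (by omega), if_neg h]

/-- The real certificate matrix at `G = 1 + π⁻¹S` is the cast pencil at `t = π⁻¹`. [folklore] -/
private theorem certMatrix_eq_pencil (X : Matrix (Fin m) (Fin m) ℚ) (c' : Fin m → ℚ) (μ : ℚ) :
    certMatrix (Matrix.of fun i j : Fin m ↦ halfSinc ((j : ℤ) - (i : ℤ))) (X.map (Rat.castHom ℝ))
        (fun i ↦ (c' i : ℝ)) (μ : ℝ)
      = (zRat₀ X c' μ).map (Rat.castHom ℝ) - (π⁻¹ : ℝ) • (zRat₁ X μ).map (Rat.castHom ℝ) := by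
  rw [certMatrix, gram_eq_one_add, map_zRat₀, map_zRat₁]
  set Xr := X.map (Rat.castHom ℝ)
  set Sr := (sRat m).map (Rat.castHom ℝ)
  rw [show Xr * (1 + (π⁻¹ : ℝ) • Sr) * Xr = Xr * Xr + (π⁻¹ : ℝ) • (Xr * Sr * Xr) by
    rw [Matrix.mul_add, Matrix.mul_one, Matrix.add_mul, Matrix.mul_smul, Matrix.smul_mul]]
  module

/-- RH-FREE. **The low-block inequality from a rational certificate.**  On CC's window `[−L/2, L/2]`, for
the `m = 2n₀+1` exponentials `f_i = ξ_{(i − n₀)/2}` (`i < m`) with weights `c′_i`, a rational symmetric `X`,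
`0 ≤ μ`, rationals `t₋ ≤ π⁻¹ ≤ t₊`, and the two rational matrices `Z(t±) = μ(2X − X(1 + t± S)X) − diag c′`
positive semidefinite (e.g. by `PSDCert.ldltCheck`), one has `Σ_i c′_i |⟪f_i, ξ⟫|² ≤ μ‖ξ‖²` for all `ξ`.
[cite: ConnesConsani2021, Lemma 6.6 §6.6 pp. 25–26 (the Gram matrix); folklore] -/
theorem lowBlock_of_rationalCert {L : ℝ} (hL : 0 < L) (n₀ : ℕ) (X : Matrix (Fin (2 * n₀ + 1)) (Fin (2 * n₀ + 1)) ℚ)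
    (hXs : ∀ i j, X i j = X j i) (c' : Fin (2 * n₀ + 1) → ℚ) {μ tlo thi : ℚ} (hμ : 0 ≤ μ)
    (hlo : (tlo : ℝ) ≤ π⁻¹) (hhi : π⁻¹ ≤ (thi : ℝ))
    (h₀ : ((zRat X c' μ tlo).map (Rat.castHom ℝ)).PosSemidef)
    (h₁ : ((zRat X c' μ thi).map (Rat.castHom ℝ)).PosSemidef)
    (ξ : Lp ℂ 2 (volume.restrict (Icc (-(L / 2)) (L / 2)))) :
    ∑ i : Fin (2 * n₀ + 1), (c' i : ℝ) * ‖⟪expVector (-(L / 2)) (L / 2) ((((i : ℕ) : ℤ) - n₀ : ℤ) / 2 : ℝ), ξ⟫_ℂ‖ ^ 2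
      ≤ (μ : ℝ) * ‖ξ‖ ^ 2 := by
  set f : Fin (2 * n₀ + 1) → Lp ℂ 2 (volume.restrict (Icc (-(L / 2)) (L / 2))) :=
    fun i ↦ expVector (-(L / 2)) (L / 2) ((((i : ℕ) : ℤ) - n₀ : ℤ) / 2 : ℝ) with hf
  set G : Matrix (Fin (2 * n₀ + 1)) (Fin (2 * n₀ + 1)) ℝ := Matrix.of fun i j ↦ halfSinc ((j : ℤ) - (i : ℤ))
    with hGdef
  have hG : ∀ i j, ⟪f i, f j⟫_ℂ = ((G i j : ℝ) : ℂ) := fun i j ↦ by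
    rw [hf, hGdef, Matrix.of_apply]
    simp only
    rw [show ((((i : ℕ) : ℤ) - n₀ : ℤ) / 2 : ℝ) = (((((i : ℕ) : ℤ) - n₀ : ℤ)) : ℝ) / 2 by norm_cast,
      show ((((j : ℕ) : ℤ) - n₀ : ℤ) / 2 : ℝ) = (((((j : ℕ) : ℤ) - n₀ : ℤ)) : ℝ) / 2 by norm_cast,
      inner_expVector_halfInt hL]
    congr 2
    ring
  have hXs' : ∀ i j, (X.map (Rat.castHom ℝ)) i j = (X.map (Rat.castHom ℝ)) j i := fun i j ↦ by
    simp only [Matrix.map_apply, hXs i j]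
  have hZ : ∀ x, 0 ≤ qform (certMatrix G (X.map (Rat.castHom ℝ)) (fun i ↦ (c' i : ℝ)) (μ : ℝ)) x := by
    intro x
    rw [hGdef, certMatrix_eq_pencil]
    refine qform_nonneg_of_endpoints _ _ hlo hhi (fun y ↦ ?_) (fun y ↦ ?_) x
    · have := qform_nonneg_of_posSemidef h₀ y; rwa [map_zRat] at this
    · have := qform_nonneg_of_posSemidef h₁ y; rwa [map_zRat] at this
  have hμ' : (0 : ℝ) ≤ (μ : ℝ) := by exact_mod_cast hμ
  exact sum_mul_norm_inner_sq_le_of_psd f G (X.map (Rat.castHom ℝ)) (fun i ↦ (c' i : ℝ)) hμ' hG hXs' hZ ξ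

end LowBlock

/-! ## The single entry point for the data file: `hpos` on `[−L/2, L/2]` from rational certificate data -/

section Entry

open Matrix

/-- The low-block weights `c′_i = c_{|i − n₀|} − a₀[i = n₀]` on `Fin (2n₀+1)`. [folklore] -/
def lowWeights (n₀ : ℕ) (c : ℕ → ℚ) (a₀ : ℚ) (i : Fin (2 * n₀ + 1)) : ℚ :=
  c (((i : ℕ) : ℤ) - n₀).natAbs - if (i : ℕ) = n₀ then a₀ else 0

/-- Reindexing `Fin (2n₀+1) ≃ [−n₀, n₀] ∩ ℤ`, `i ↦ i − n₀`. [folklore] -/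
private theorem sum_Icc_eq_sum_fin (n₀ : ℕ) (g : ℤ → ℝ) :
    ∑ n ∈ Finset.Icc (-(n₀ : ℤ)) n₀, g n = ∑ i : Fin (2 * n₀ + 1), g (((i : ℕ) : ℤ) - n₀) := by
  have himg : Finset.image (fun i : Fin (2 * n₀ + 1) ↦ (((i : ℕ) : ℤ) - n₀)) Finset.univ
      = Finset.Icc (-(n₀ : ℤ)) n₀ := by
    ext n
    simp only [Finset.mem_image, Finset.mem_univ, true_and, Finset.mem_Icc]
    constructor
    · rintro ⟨i, rfl⟩; have := i.2; omega
    · intro h; exact ⟨⟨(n + n₀).toNat, by omega⟩, by simp; omega⟩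
  rw [← himg, Finset.sum_image]
  intro i _ j _ h
  exact Fin.ext (by simpa using h)

/-- RH-FREE. **Entry point of the Route A-F certificate.**  Window `[−L/2, L/2]` (CC: `L = log 2`), a
kernel `ϖ ∈ L¹[−L, L]` (CC: `ϖ_G`), rational data `N, n₀, c : ℕ → ℚ, a₀, μ, ε₁, X, t±` and:
(analytic input) `∫_{−L}^{L}|τ_c − ϖ| ≤ ε₁`; (data checks) `n₀ ≤ N`, `μ + ε₁ ≤ 1`, `0 ≤ μ`, `c_n ≤ 0` for
`n₀ < n ≤ N`, `X` symmetric, `t₋ ≤ π⁻¹ ≤ t₊`, `Z(t₋) ⪰ 0`, `Z(t₊) ⪰ 0` (rational PSD, e.g. `PSDCert.ldltCheck`)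
⟹ `∀ ξ, 0 ≤ Re⟪ξ, ξ − windowOp ϖ ξ⟫ + a₀|⟪η₀, ξ⟫|²` (= `hpos` of
`MainInequalityAssembly.weilArchPositivity_soninTrace_fine_of_opIneq`, binder K3 `WindowSpectralBound`).
[cite: ConnesConsani2021, Lemma 6.3 §6.4 p. 24; Lemma 6.10 §6.7 p. 28] -/
theorem opIneq_of_rationalFrameCert {L : ℝ} (hL : 0 < L) {ϖ : ℝ → ℂ}
    (hϖ : IntegrableOn ϖ (Icc (-(L / 2) - L / 2) (L / 2 - -(L / 2))))
    {N n₀ : ℕ} (hn : n₀ ≤ N) (c : ℕ → ℚ) {a₀ μ ε₁ tlo thi : ℚ}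
    (X : Matrix (Fin (2 * n₀ + 1)) (Fin (2 * n₀ + 1)) ℚ) (hXs : ∀ i j, X i j = X j i)
    (hL1 : ∫ v in Icc (-(L / 2) - L / 2) (L / 2 - -(L / 2)),
      ‖frameKernel (-(L / 2)) (L / 2) N (fun n ↦ (c n : ℝ)) v - ϖ v‖ ≤ (ε₁ : ℝ))
    (hμ : μ + ε₁ ≤ 1) (hμ0 : 0 ≤ μ) (hneg : ∀ n : ℕ, n₀ < n → n ≤ N → c n ≤ 0)
    (hlo : (tlo : ℝ) ≤ π⁻¹) (hhi : π⁻¹ ≤ (thi : ℝ))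
    (h₀ : ((zRat X (lowWeights n₀ c a₀) μ tlo).map (Rat.castHom ℝ)).PosSemidef)
    (h₁ : ((zRat X (lowWeights n₀ c a₀) μ thi).map (Rat.castHom ℝ)).PosSemidef)
    (ξ : Lp ℂ 2 (volume.restrict (Icc (-(L / 2)) (L / 2)))) :
    0 ≤ RCLike.re ⟪ξ, ξ - windowOp (-(L / 2)) (L / 2) hϖ ξ⟫_ℂ
          + (a₀ : ℝ) * ‖⟪constVector (-(L / 2)) (L / 2), ξ⟫_ℂ‖ ^ 2 := by
  have hab : -(L / 2) < L / 2 := by linarith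
  have hμ' : (μ : ℝ) + (ε₁ : ℝ) ≤ 1 := by exact_mod_cast hμ
  refine opIneq_of_frameCertificate (μ := (μ : ℝ)) (a₀ := (a₀ : ℝ)) hab hϖ hn (fun n ↦ (c n : ℝ)) hL1 hμ'
    (fun n h1 h2 ↦ by exact_mod_cast hneg n h1 h2) (fun ζ ↦ ?_) ξ
  have hlow := lowBlock_of_rationalCert hL n₀ X hXs (lowWeights n₀ c a₀) hμ0 hlo hhi h₀ h₁ ζ
  rw [sum_Icc_eq_sum_fin]
  convert hlow using 2 with i
  simp only [lowWeights, Rat.cast_sub]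
  congr 2
  · have : ((((i : ℕ) : ℤ) - n₀ : ℤ) = 0) ↔ ((i : ℕ) = n₀) := by omega
    simp only [this]
    split_ifs <;> simp

end Entry






end SpectralCert

end Literature.NumberTheory.ConnesConsani2021

end
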